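import Literature.MathematicalPhysics.QuantumFieldTheory.BalabanImbrieJaffe1984to88.BIJ88LocatedActivityBoundSizeFree309
import Literature.MathematicalPhysics.QuantumFieldTheory.BalabanImbrieJaffe1984to88.BIJ88TrainDecayLetter309
import Literature.MathematicalPhysics.QuantumFieldTheory.BalabanImbrieJaffe1984to88.BIJ88TrainGainAssembly309
import Literature.MathematicalPhysics.QuantumFieldTheory.BalabanImbrieJaffe1984to88.BIJ88TrainCountingBudget307
import Literature.MathematicalPhysics.QuantumFieldTheory.BalabanImbrieJaffe1984to88.BIJ88TrainGeometryLetters309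
import Literature.MathematicalPhysics.QuantumFieldTheory.BalabanImbrieJaffe1984to88.BIJ88Ineq5144Located

/-!
# `BalabanImbrieJaffe1984to88.BIJ88Ineq5144SizeFree309` — T. Bałaban, J. Imbrie, A. Jaffe, *Effective action and cluster properties of the
abelian Higgs model*, Commun. Math. Phys. **114** (1988) 257–315 [BalabanImbrieJaffe1988], Sect. 5.14, (5.14.4) p. 309 [PDF 53] L12–15:
*"Let us drop the prime, and prove that (5.14.4) |g₃(H_β, X_β)| ≦ (e^β(L^kε/ε₀)^{1/4−α})^{[|H_β| + β′|X_β∖H_β|]}. We use X_β∖H_β to denote the set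
of cubes with no (d/dt)_{γ_j} factors, j ∈ H_β. The proof of this estimate is similar to the one for g₂"*, with Sect. 5.13 p. 307 [PDF 51] L2–23
(verbatim in `BIJ88TrainGainAssembly309`, `BIJ88TrainCountingBudget307`) — **THE LOCATED (5.14.4) ON THE LINEAGE'S MODEL, SIZE-FREE**:
`|g₃(H, X″)| ≤ θ^{|H| + β′|X″∖X_H|}` for EVERY `|X″| ≥ 2`, every decoration pattern, the coupled covariance `Δ_{1_Λ}`, `t ∈ (0,1]`, sitewise-bounded
sources (HONEST SCOPE (1)), under LETTERS INDEPENDENT OF `|X″|` — the per-cube smallness `θ^{β′}` bought, as in print, by the decay of the trains across the cubes (*"If the walk ω(α)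
wanders through more than a few cubes, we begin to pickup factors e^{−cr(e_k)}. These control the sum over walks and partitions, and the
factorials, as in [9]"*), NOT by one small factor spread over a bounded number of cubes (`BIJ88Ineq5144BoundedSize309`).

Assembly (HOME `lit-balaban-p36/ASSEMBLY-PLAN.md`): the size-free master bound `BIJ88LocatedActivityBoundSizeFree309.abs_actIn_le_master_sizeFree` (Σ over vertex structures
σ, groupings P, end data E, slot assignments g) ∘ the train-level decay letter `BIJ88TrainDecayLetter309.abs_prec_inv_mul_wker_apply_le_anchors`
(certificates `κ_c(x,y) ≤ a₀A₁^{|c|}Σ_ℓ e^{−μ′(Dist({x},S_{ℓ₁}) + |ℓ| + Dist(S_{last anchor},{y}))}`, derived from `Δ`-letters) ∘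
`BIJ88TrainGainAssembly309.sum_endData_sum_asg_le_of_kernel` (Σ_E Σ_g: every train a gain `ϑ`, every `t`-derivative a `θ`) ∘
`BIJ88TrainCountingBudget307` (Σ_ℓ Σ_P Σ_σ: [9] Prop. 8.2, coupled pairings, `2|σ| ≥ |X″|`) ∘ `BIJ88TrainGeometryLetters309` (the geometric
letters from the site metric and the cube metric).

statement-level skeleton of published theorems with citation tags; proofs where landed; nothing here is a claim about the Yang–Mills mass gap

PDF held: `paper:balaban1988-cmp114-bij-abelian-higgs-effective-action` p. 307 (p0051 L2–27), p. 309 (p0053 L10–30) re-read this session as text.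

CITATION HEADER (lean-in-tree rule).  Part of the lit-balaban TYPED SKELETON (HOME `run/shared/lean/pub/lit-balaban/`), Phase 2, seat p36
(gen 23–24, unit `lit-balaban-p36`); rows **C2.Eq5.14.3-5.14.4** (member: the size-free located (5.14.4) — candidate instance for the leaf
`h5144three` of `BIJ88Eq5145HeadThreeCubeChi.eq5145_zG_mod_W6v_of_ineq5144_three_le_struct_chi`) and C2.Eq5.13.3-5.13.4 (member) of
`HOME/lit-balaban-r16/ROWS-C2-part2.md` (owner r16, referee ref-5).  Theorem-only; no definitions, no `Prop` facts; axioms standard.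
THE CLASS (data) = that of `BIJ88Ineq5144BoundedSize309` WITHOUT `N₀`: sites `α`, cubes `I`, `blk`, precision `Δ ≻ 0` with `m·1 ≤ Δ ≤ C₀·1`,
source `ℱ` (`|ℱ_q| ≤ F_q ≤ F₀` sitewise; no ℓ²-mass hypothesis), χ-slots (linear `Φ_b`, `c_b ≠ 0`, profile `χ`, `p`, `e_k`, `0 < t ≤ 1`, `te_k < 1`) and `V`-slots
(`V_Y ∈ C_b^∞`) in cubes, EVERY decoration pattern, region `X`, labels `γ′`, `H`, polymer `X″` with `|X″| ≥ 2` and a site, coupled covariance.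
THE LETTERS (all independent of `|X″|`; module docstrings of the four assembly files): SITE GEOMETRY — a pseudometric `d` on sites with `Δ`
banded (`d > 1 ⇒ Δ_{xy} = 0`), off-diagonal size `h`, local volume `z`, Combes–Thomas smallness `hz(e^μ−1) ≤ m/2`, site lattice sum `Z`; CUBE
GEOMETRY — a symmetric cube metric `cd ≥ 0` with the scale letter `r·cd(blk x,blk y) − r₀ ≤ d(x,y)` (`r` = side of the cubes, `r₀+2 ≤ 2r`), growth
`#{i ∈ X″ : cd(i₀,i) < k} ≤ C_g k^{dim}`, `≤ C₂` cubes of `X″` within `cd < 2`, cube lattice sums `Z_c` (rate `μ/8`, threshold `r₀+1`) and `Z_{c,2}` (rate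
`μr/8`); sites per cube `z_c`, located slots per cube `s₀`; SLOTS — locality `w_τ(x) ≠ 0 ⇒ blk x = cube τ`, `Σ_x w_τ(x) ≤ w₁`, Gevrey letters
`t^mA_b(m,n) ≤ Aχ^{[m≠0]}aχ^n(n!)^s` and `A_Y(m,n) ≤ A_Vθ_V^{m+n}a_V^n(n!)^s` for multiplicities `m ≤ M`, `A_b(0,0) ≤ 1`, shells `2e^{−a_b(a_b−2Λ_∞(2/m)F₀Z)/(2Λ²/m)} ≤ (te_k)^Mθ_S` (size-free drift, `BIJ88SlotDriftLetter309`) with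
label multiplicity `≤ M` per slot, `θ_S ≤ η²`, `Aχη ≤ 1`; GAINS — `e_k ≤ θ ≤ 1`, `θ_V ≤ θ`, `η^{1/N_n} ≤ ϑ ≤ 1`, `θ_V ≤ ϑ`,
`e^{−(μ/8)(2r−(r₀+1))} ≤ ϑ`, `2C_g2^{dim} ≤ N_n`, factorial control `2s·dim·(4C_g)^{1/dim} ≤ μr/4`; COUNTING — the per-train smallness
`a₀ϑR₂e^{λ′r₁} ≤ 1` (`a₀ = 2/m`, `r₁ = 2r−(r₀+2)`, `R₂ = F₁R₁+½R₁²` explicit, `0 ≤ λ′ ≤ μ/8`), sparseness `2(c₀+1)!G ≤ 1` (`c₀ = 2C₂`, `G ≥ e^{−(μ/8)r₁}e^{(μ/8)(r₀+2)}2Z_{c,2}`), a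
per-block ratio `ρ ≤ 1` with `A₁qe^{2(c₀+1)!} ≤ ρ²` (`A₁ = (2/m)Z(2hz)e^{μ/2}` the train letter's per-boundary constant, `q = e^{−λ′r₁/(c₀+1)}`), and the
FINAL SMALLNESS `(C₂+1)·A_V^{s₀}·ρ ≤ θ^{β′}`.
θ-ACCOUNTING (print (5.14.4)): `θ^{|H|}` slot by slot as in the bounded-size instance; `θ^{β′|X″∖X_H|} ≤ θ^{β′|X″|}`-type factor from ONE `ρ` PER CUBE
(`2|σ| ≥ |X″|`), `ρ` collecting per block the boundary factor `q` (anchor decay of its train, paid once per train by the train's gain `ϑ^{1/2}`-type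
budget), [9]'s `e^{2(c₀+1)!}` and the model's per-boundary constant `A₁`.
HONEST SCOPE.  (1) THE SOURCE CLASS IS SITEWISE-BOUNDED, NOT ℓ²-BOUNDED ON THE REGION (owner pre-filing review v2.386, road (α) taken BEFORE
filing): the shells come from the size-free master bound `BIJ88LocatedActivityBoundSizeFree309.abs_actIn_le_master_sizeFree`, whose drift is
the LOCAL one `Λ_∞(2/m)F₀Z` of `BIJ88SlotDriftLetter309` (decay of `(Δ_s|_X″)⁻¹` + `|ℱ| ≤ F₀` on the sites of `X″` + the site lattice sum + the ℓ^∞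
slot letter `Λ_∞`; p. 307 L11–13) — there is NO hypothesis on `‖ℱ↾X″‖₂`; the earlier master bound's `2ΛF/m` is gone.  (2) Every size is a LETTER
(hypothesis); the χ-letter is dischargeable by `BIJ88ChiSlotDsetBound309` only up to the Gevrey form stated here (print's *"factorials"* for
`C(χ,p,m,n)`), the `V`-letter is r16's typing gap #1 in all-orders form; linear χ-slot fields; a site in `X″`.
No non-vacuity certificate in this file (the smallness letters are consistent for `r` large and `θ_S, θ_V, F₀` small — to be certified on a toy
datum as `BIJ88Ineq5144BoundedSizeToy` did).  NOT summit progress; NOT continuum; NOT Clay.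

REVISION (doc-only, owner item N-owner-g31-1): the factorial-control letter in the module docstring now reads `(4C_g)^{1/dim}` as the binder `hfac` does; no declaration changed.
-/


namespace Literature.MathematicalPhysics.QuantumFieldTheory.BalabanImbrieJaffe1984to88.BIJ88Ineq5144SizeFree309

open Finset Matrix
open scoped BigOperators
open Literature.Probability.LatticeModels (setPartitions IsSetPartition mem_setPartitions)
open BIJ88DirichletForms305 (interpForm)
open BIJ88PairingAllOrders5133 (smallParts mem_smallParts)
open BIJ88WickSourceSmooth305 (dset)
open BIJ88SmoothFactors5133 (CbInf)
open BIJ88TrainPieces306 (wker)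
open BIJ88TrainsDsetExpansion306 (trainLegs trainSite legsAt)
open BIJ88TruncationConnected5133 (bmat)
open BIJ88PolymerRep5134 (corner)
open BIJ88PolymerRep5134Gauss (prec src ext)
open BIJ88Sect5Statements (CutoffProfile)
open BIJ88SlotMomentsGauss308 (uD)
open BIJ88Eq5145CornerModel (slotB slotY)
open BIJ88Eq5145CornerUrsell (cubeIn)
open BIJ88W6PrimeVsupp (actIn)
open BIJ88Ineq5144Located (locAct locAct_of_loc locAct_of_not_loc)
open BIJ88LocatedActivityBoundSizeFree309 (abs_actIn_le_master_sizeFree)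
open BIJ88WalkItinerary307 (sdist chainLen sdist_nonneg exists_sdist_eq sdist_le le_sdist)
open BIJ88OrderingAnchors307 (anchors anchorsFrom anchorLen)

variable {α I : Type} [Fintype α] [DecidableEq α] [Fintype I] [DecidableEq I] (blk : α → I) (Δ : Matrix α α ℝ) (ℱ : α → ℝ)
variable (χ : CutoffProfile) {ι υ : Type} [DecidableEq ι] [DecidableEq υ] (p : ℝ) {ek t : ℝ} (B : Finset ι)
  {Φ : ι → (α → ℝ) → ℝ} {c : ι → ℝ} (Ys : Finset υ) {V : υ → (α → ℝ) → ℝ} (cube : ↥B ⊕ ↥Ys → I)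
variable (adj : I → I → Prop) [DecidableRel adj] (Λc : Finset I)

set_option maxHeartbeats 1600000 in
/-- **THE LOCATED (5.14.4), SIZE-FREE, LOCATED `H`** (p. 309 L12–28 with p. 307 L2–23; the class and the letters in the module docstring):
for `|X″| ≥ 2` and every label of `H` located in `X″`, `|actIn … H X″| ≤ θ^{|H| + β′·|X″ ∖ X_H|}`, `X_H = (cubeIn cube X ∘ γ′)'' H`, with letters
independent of `|X″|`. [cite: BalabanImbrieJaffe1988, (5.14.4) p.309 L12–28; §5.13 p.305–307] [cite: GlimmJaffeSpencer1973, Prop. 8.1–8.2, Thm. 9.4, Lemma 10.2] -/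
theorem abs_actIn_le_rpow_sizeFree (hΔ : Δ.PosDef) {m C₀ : ℝ} (hm : 0 < m)
    (hΔm : ∀ φ : α → ℝ, m * (φ ⬝ᵥ φ) ≤ φ ⬝ᵥ (Δ *ᵥ φ)) (hCΔ : ∀ v, v ⬝ᵥ (Δ *ᵥ v) ≤ C₀ * (v ⬝ᵥ v))
    (hek : 0 < ek) (ht : 0 < t) (h1 : t * ek < 1) (hΦ : ∀ b ∈ B, IsLinearMap ℝ (Φ b)) (hc : ∀ b ∈ B, c b ≠ 0)
    (hV : ∀ Y ∈ Ys, CbInf (V Y))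
    (X : Finset I) {S : Type*} [DecidableEq S] (γ' : S → ↥(slotB B Ys cube X) ⊕ ↥(slotY B Ys cube X)) (H : Finset S)
    {X'' : Finset I} (h2 : 2 ≤ X''.card) (hXs : ∃ x, blk x ∈ X'') (τ₀ : ↥(slotB B Ys cube X) ⊕ ↥(slotY B Ys cube X))
    {Λ : ℝ} (hΛ : 0 < Λ)
    (hframe : ∀ (θ : ↥(univ.filter fun b : ↥(slotB B Ys cube X) => cubeIn cube X (Sum.inl b) ∈ X'') → ℝ) (φ : α → ℝ),
      |∑ b, θ b * Φ b.1.1 φ| ≤ Λ * Real.sqrt (∑ b, θ b ^ 2) * Real.sqrt (φ ⬝ᵥ φ))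
    {a a' : ↥(slotB B Ys cube X) → ℝ} (ha : ∀ b, 0 ≤ a b)
    {A : ↥(slotB B Ys cube X) ⊕ ↥(slotY B Ys cube X) → ℕ → ℕ → ℝ} (hA : ∀ τ m n, 0 ≤ A τ m n)
    (hA1 : ∀ b : ↥(slotB B Ys cube X), 1 ≤ A (Sum.inl b) 0 0)
    {w : ↥(slotB B Ys cube X) ⊕ ↥(slotY B Ys cube X) → BIJ88PolymerRep5134Gauss.Site blk X'' → ℝ} (hw : ∀ τ x, 0 ≤ w τ x)
    (hχ : ∀ (κ : Type) [LinearOrder κ] (q : κ → BIJ88PolymerRep5134Gauss.Site blk X'') (b : ↥(slotB B Ys cube X)) (m : ℕ)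
      (D' : Finset κ) (φ : BIJ88PolymerRep5134Gauss.Site blk X'' → ℝ), (m ≠ 0 ∨ D'.card ≠ 0) →
      |dset (fun j => Pi.single (q j) (1 : ℝ)) D'
        (fun ψ => uD χ p ek (slotB B Ys cube X) (fun b : ↥B => Φ b) (fun b : ↥B => c b) (slotY B Ys cube X) (fun Y : ↥Ys => V Y) t
          (Sum.inl b) m (ext blk X'' ψ)) φ| ≤
        A (Sum.inl b) m D'.card * (∏ j ∈ D', w (Sum.inl b) (q j)) *
          Set.indicator (Set.Icc (a b) (a' b)) (fun _ => (1 : ℝ)) |Φ b.1 (ext blk X'' φ)|)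
    (hY : ∀ (κ : Type) [LinearOrder κ] (q : κ → BIJ88PolymerRep5134Gauss.Site blk X'') (Y : ↥(slotY B Ys cube X)) (m : ℕ)
      (D' : Finset κ) (φ : BIJ88PolymerRep5134Gauss.Site blk X'' → ℝ),
      |dset (fun j => Pi.single (q j) (1 : ℝ)) D'
        (fun ψ => uD χ p ek (slotB B Ys cube X) (fun b : ↥B => Φ b) (fun b : ↥B => c b) (slotY B Ys cube X) (fun Y : ↥Ys => V Y) t
          (Sum.inr Y) m (ext blk X'' ψ)) φ| ≤
        A (Sum.inr Y) m D'.card * ∏ j ∈ D', w (Sum.inr Y) (q j))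
    {Fq : BIJ88PolymerRep5134Gauss.Site blk X'' → ℝ} (hFq : ∀ q : BIJ88PolymerRep5134Gauss.Site blk X'', |ℱ q.1| ≤ Fq q)
    -- SITE GEOMETRY (the `Δ`-letters of `BIJ88TrainDecayLetter309`)
    (d : α → α → ℝ) (hd0 : ∀ i, d i i = 0) (hdsymm : ∀ i k, d i k = d k i) (hdtri : ∀ i j k, d i k ≤ d i j + d j k)
    (hband : ∀ x y, 1 < d x y → Δ x y = 0) {hΔoff : ℝ} (hh0 : 0 ≤ hΔoff) (hh : ∀ x y, x ≠ y → |Δ x y| ≤ hΔoff)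
    {z : ℝ} (hz : ∀ x, ((univ.filter fun y => y ≠ x ∧ d x y ≤ 1).card : ℝ) ≤ z) {μ : ℝ} (hμ : 0 ≤ μ)
    (hsmallCT : hΔoff * z * (Real.exp μ - 1) ≤ m / 2) {Z : ℝ}
    (hZ : ∀ y : BIJ88PolymerRep5134Gauss.Site blk X'', ∑ x : BIJ88PolymerRep5134Gauss.Site blk X'', Real.exp (-(μ / 2 * d y.1 x.1)) ≤ Z)
    -- CUBE GEOMETRY
    (cd : I → I → ℝ) (hcd0 : ∀ i i', 0 ≤ cd i i') (hcdsymm : ∀ i i', cd i i' = cd i' i) {r r₀ : ℝ} (hr : 0 < r) (hr2 : r₀ + 2 ≤ 2 * r)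
    (hgeo : ∀ x y : α, r * cd (blk x) (blk y) - r₀ ≤ d x y) {Cg : ℝ} {dim : ℕ} (hCg : 0 < Cg) (hdim : dim ≠ 0)
    (hgrowth : ∀ (i₀ : I) (kk : ℕ), 1 ≤ kk → ((X''.filter fun i => cd i₀ i < kk).card : ℝ) ≤ Cg * (kk : ℝ) ^ dim)
    {C2 : ℕ} (hC2 : ∀ i, (X''.filter fun i' => cd i i' < 2).card ≤ C2)
    {Zc : ℝ} (hZc : ∀ i', ∑ i ∈ X'', Real.exp (-(μ / 2 / 4 * max (r * cd i i' - (r₀ + 1)) 0)) ≤ Zc)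
    {Zc2 : ℝ} (hZc2 : ∀ i, ∑ i' ∈ X'', Real.exp (-(μ / 2 / 2 / 2 * r * cd i i')) ≤ Zc2)
    {zc : ℝ} (hzc : ∀ i, ((univ.filter fun x : α => blk x = i).card : ℝ) ≤ zc)
    {s₀ : ℕ} (hs₀ : ∀ i ∈ X'', (univ.filter fun τ : ↥(slotB B Ys cube X) ⊕ ↥(slotY B Ys cube X) => cubeIn cube X τ = i).card ≤ s₀)
    {F₀ : ℝ} (hFq1 : ∀ y, Fq y ≤ F₀)
    {Λinf : ℝ} (hΦinf : ∀ b : ↥(slotB B Ys cube X), ∀ (φ : α → ℝ) (M : ℝ), 0 ≤ M → (∀ x, |φ x| ≤ M) → |Φ b.1 φ| ≤ Λinf * M)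
    -- SLOTS
    {θ θS θV η Aχ AV aχ aV sG ϑ w₁ : ℝ} {M Nn : ℕ} (ht1 : t ≤ 1) (hekθ : ek ≤ θ) (hθ1 : θ ≤ 1) (hθS0 : 0 ≤ θS) (hη0 : 0 ≤ η)
    (hη1 : η ≤ 1) (hθSη : θS ≤ η * η) (hAχ0 : 0 ≤ Aχ) (hAχη : Aχ * η ≤ 1) (haχ : 0 ≤ aχ) (hθV0 : 0 ≤ θV) (hθVθ : θV ≤ θ)
    (hAV : 1 ≤ AV) (haV : 0 ≤ aV) (hsG : 0 ≤ sG) (hNn : 1 ≤ Nn) (hϑ0 : 0 ≤ ϑ) (hϑ1 : ϑ ≤ 1) (hηϑ : η ^ ((Nn : ℝ)⁻¹) ≤ ϑ)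
    (hθVϑ : θV ≤ ϑ) (hfar : Real.exp (-(μ / 2 / 4 * (2 * r - (r₀ + 1)))) ≤ ϑ)
    (hfac : 2 * sG * (dim * (2 * (2 * Cg)) ^ ((dim : ℝ)⁻¹)) ≤ μ / 2 / 2 * r) (hNn2 : 2 * Cg * 2 ^ dim ≤ (Nn : ℝ))
    (hwloc : ∀ τ x, w τ x ≠ 0 → blk x.1 = cubeIn cube X τ)
    (hw₁ : 0 ≤ w₁) (hw1 : ∀ τ, ∑ x, w τ x ≤ w₁)
    (hAχ' : ∀ b : ↥(slotB B Ys cube X), cubeIn cube X (Sum.inl b) ∈ X'' → ∀ md nd : ℕ, md ≤ M → (md ≠ 0 ∨ nd ≠ 0) →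
      t ^ md * A (Sum.inl b) md nd ≤ Aχ ^ (if md ≠ 0 then 1 else 0) * (aχ ^ nd * ((nd.factorial : ℕ) : ℝ) ^ sG))
    (hA10 : ∀ b : ↥(slotB B Ys cube X), A (Sum.inl b) 0 0 ≤ 1)
    (hAV' : ∀ (Y : ↥(slotY B Ys cube X)) (md nd : ℕ), md ≤ M →
      A (Sum.inr Y) md nd ≤ AV * θV ^ (md + nd) * (aV ^ nd * ((nd.factorial : ℕ) : ℝ) ^ sG))
    (hS : ∀ b : ↥(slotB B Ys cube X), cubeIn cube X (Sum.inl b) ∈ X'' →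
      2 * Real.exp (-(a b * (a b - 2 * (Λinf * (2 / m * F₀ * Z))) / (2 * (Λ ^ 2 / m)))) ≤ (t * ek) ^ M * θS)
    (hHM : ∀ τ, (H.filter fun j => γ' j = τ).card ≤ M)
    -- COUNTING
    {lam' G ρ β' F₁ Zs : ℝ} (hlam' : 0 ≤ lam') (hlam'2 : lam' ≤ μ / 2 / 2 / 2)
    (hF₁ : F₀ * ((2 : ℝ) * (zc * (z + 1))) * Z ≤ F₁) (hZs : (s₀ : ℝ) * (4 * Zc) ≤ Zs)
    (hp₁ : 2 / m * (ϑ * (F₁ * (max aχ aV * (Real.exp (sG * (dim * (2 * (2 * Cg)) ^ ((dim : ℝ)⁻¹))) *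
        Real.exp (μ / 2 / 2 * (r₀ + 1))) * w₁ * Zs) + 1 / 2 * (max aχ aV * (Real.exp (sG * (dim * (2 * (2 * Cg)) ^ ((dim : ℝ)⁻¹))) *
        Real.exp (μ / 2 / 2 * (r₀ + 1))) * w₁ * Zs) ^ 2)) * Real.exp (lam' * (2 * r - (r₀ + 2))) ≤ 1)
    (hG : Real.exp (-(μ / 2 / 2 / 2 * (2 * r - (r₀ + 2)))) * Real.exp (μ / 2 / 2 / 2 * (r₀ + 2)) * (2 * Zc2) ≤ G)
    (hsmallG : 2 * ((2 * C2 + 1).factorial : ℝ) * G ≤ 1) (hρ0 : 0 ≤ ρ) (hρ1 : ρ ≤ 1)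
    (hρ : 2 / m * Z * (2 * hΔoff * z) * Real.exp (μ / 2 * 1) * Real.exp (-(lam' * (2 * r - (r₀ + 2)) / ((2 * C2 : ℕ) + 1))) *
      Real.exp (2 * ((2 * C2 + 1).factorial : ℝ)) ≤ ρ ^ 2)
    (hβ : 0 ≤ β') (hfinal : ((C2 : ℝ) + 1) * AV ^ s₀ * ρ ≤ θ ^ β')
    (hHloc : ∀ j ∈ H, cubeIn cube X (γ' j) ∈ X'') :
    |actIn blk Δ ℱ adj χ p ek B Φ c Ys V cube Λc X t γ' H X''| ≤
      θ ^ ((H.card : ℝ) + β' * ((X'' \ H.image (cubeIn cube X ∘ γ')).card : ℝ)) := by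
  classical
  -- D1. the crossing sets, the supports, the touching relation and the certificates
  set K : Finset I → Finset (BIJ88PolymerRep5134Gauss.Site blk X'' × BIJ88PolymerRep5134Gauss.Site blk X'') := fun b =>
    univ.filter fun p => (blk p.1.1 ∈ b ∨ blk p.2.1 ∈ b) ∧ (b.card ≠ 1 → blk p.1.1 ∈ b ∧ blk p.2.1 ∈ b) ∧ blk p.1.1 ≠ blk p.2.1 ∧
      (Δ p.1.1 p.2.1 ≠ 0 ∨ Δ p.2.1 p.1.1 ≠ 0) with hKdef
  have hK : ∀ (b : Finset I) (x x'' : BIJ88PolymerRep5134Gauss.Site blk X''), (blk x.1 ∈ b ∨ blk x''.1 ∈ b) →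
      (b.card ≠ 1 → blk x.1 ∈ b ∧ blk x''.1 ∈ b) → blk x.1 ≠ blk x''.1 → (Δ x.1 x''.1 ≠ 0 ∨ Δ x''.1 x.1 ≠ 0) → (x, x'') ∈ K b :=
    fun b x x'' h1 h2 h3 h4 => mem_filter.2 ⟨mem_univ _, h1, h2, h3, h4⟩
  have hKR : ∀ b, ∀ q ∈ K b, d q.1.1 q.2.1 ≤ 1 := by
    intro b q hq
    have h4 := (mem_filter.1 hq).2.2.2.2
    by_contra hlt
    rw [not_le] at hlt
    rcases h4 with h4 | h4
    · exact h4 (hband _ _ hlt)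
    · exact h4 (hband _ _ (by rwa [hdsymm]))
  set Sb : Finset I → Finset (BIJ88PolymerRep5134Gauss.Site blk X'') := fun b => (K b).image Prod.fst ∪ (K b).image Prod.snd with hSbdef
  have hKS : ∀ b, ∀ q ∈ K b, q.1 ∈ Sb b ∧ q.2 ∈ Sb b := fun b q hq =>
    ⟨mem_union_left _ (mem_image_of_mem _ hq), mem_union_right _ (mem_image_of_mem _ hq)⟩
  -- every site of `S_b` is within site distance `1` of a site of a cube of `b`
  have hSnear : ∀ b, ∀ y ∈ Sb b, ∃ y' : BIJ88PolymerRep5134Gauss.Site blk X'', blk y'.1 ∈ b ∧ d y.1 y'.1 ≤ 1 := by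
    intro b y hy
    rcases mem_union.1 hy with hy | hy
    · obtain ⟨q, hq, rfl⟩ := mem_image.1 hy
      have hq1 := (mem_filter.1 hq).2.1
      rcases hq1 with h | h
      · exact ⟨q.1, h, by rw [hd0]; exact zero_le_one⟩
      · exact ⟨q.2, h, hKR b q hq⟩
    · obtain ⟨q, hq, rfl⟩ := mem_image.1 hy
      have hq1 := (mem_filter.1 hq).2.1
      rcases hq1 with h | h
      · exact ⟨q.1, h, by rw [hdsymm]; exact hKR b q hq⟩
      · exact ⟨q.2, h, by rw [hd0]; exact zero_le_one⟩
  -- the site metric on the sites of `X″`, the block distance, the touching relation, the train letter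
  set dS : BIJ88PolymerRep5134Gauss.Site blk X'' → BIJ88PolymerRep5134Gauss.Site blk X'' → ℝ := fun a b => d a.1 b.1 with hdS
  set Dblk : Finset I → Finset I → ℝ := fun b b' => sdist dS (Sb b) (Sb b') with hDblk
  set touch : Finset I → Finset I → Prop := fun b u => Dblk b u < 2 * r - (r₀ + 2) with htouch
  obtain ⟨κc, hκc⟩ : ∃ κc : Finset (Finset I) → BIJ88PolymerRep5134Gauss.Site blk X'' → BIJ88PolymerRep5134Gauss.Site blk X'' → ℝ,
      κc = fun cg x y => if (∀ b ∈ cg, (K b).Nonempty) then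
        2 / m * (2 / m * Z * (2 * hΔoff * z) * Real.exp (μ / 2 * 1)) ^ cg.card *
          ∑ ℓ ∈ cg.val.lists.toFinset, Real.exp (-(μ / 2 * chainLen dS Sb y {x} (anchors touch ℓ))) else 0 := ⟨_, rfl⟩
  have hκ : ∀ s : I → ℝ, (∀ i, 0 ≤ s i ∧ s i ≤ 1) → ∀ (cg : Finset (Finset I)) (x y : BIJ88PolymerRep5134Gauss.Site blk X''),
      |((prec blk (interpForm blk Δ (corner ℝ Λc)) X'' s)⁻¹ *
          wker (prec blk (interpForm blk Δ (corner ℝ Λc)) X'' s)⁻¹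
            (fun b => bmat (fun x : BIJ88PolymerRep5134Gauss.Site blk X'' => blk x.1)
                ((interpForm blk Δ (corner ℝ Λc)).submatrix Subtype.val Subtype.val) s b
              + (bmat (fun x : BIJ88PolymerRep5134Gauss.Site blk X'' => blk x.1)
                ((interpForm blk Δ (corner ℝ Λc)).submatrix Subtype.val Subtype.val) s b)ᵀ) cg) x y| ≤ κc cg x y := by
    intro s hs cg x y
    rw [hκc]
    by_cases hne : ∀ b ∈ cg, (K b).Nonempty
    · simp only [if_pos hne]
      exact BIJ88TrainDecayLetter309.abs_prec_inv_mul_wker_apply_le_anchors blk Δ d hd0 hdsymm hdtri hband hh0 hh hz hΔ hm hΔm hμ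
        hsmallCT Λc X'' hZ K hK hKR Sb hKS touch hs cg x y
    · simp only [if_neg hne]
      simp only [not_forall, not_nonempty_iff_eq_empty, exists_prop] at hne
      obtain ⟨b, hb, hKb⟩ := hne
      rw [BIJ88TrainDecayLetter309.prec_inv_mul_wker_eq_zero_of_empty blk Δ Λc X'' K hK s hb hKb, Matrix.zero_apply, abs_zero]
  obtain ⟨x₀', hx₀'⟩ := id hXs
  have hF₀' : 0 ≤ F₀ := le_trans ((abs_nonneg _).trans (hFq ⟨x₀', hx₀'⟩)) (hFq1 _)
  have hZ0' : 0 ≤ Z := le_trans (sum_nonneg fun x _ => (Real.exp_pos _).le) (hZ ⟨x₀', hx₀'⟩)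
  refine (abs_actIn_le_master_sizeFree blk Δ ℱ χ p B Ys cube adj Λc hΔ hm hΔm hCΔ hek ht h1 hΦ hc hV X γ' H h2 hXs τ₀ hΛ hframe
    d hd0 hdsymm hdtri hband hh0 hh hz hμ hsmallCT hF₀' (fun y => (hFq y).trans (hFq1 y)) hZ0' hZ hΦinf
    ha hA hA1 hw hχ hY hκ hFq).trans ?_
  -- the coupling relation on cubes and its degree
  set adjΔ : I → I → Prop := fun i l => ∃ q : BIJ88PolymerRep5134Gauss.Site blk X'' × BIJ88PolymerRep5134Gauss.Site blk X'',
    ((blk q.1.1 = i ∧ blk q.2.1 = l) ∨ (blk q.1.1 = l ∧ blk q.2.1 = i)) ∧ (Δ q.1.1 q.2.1 ≠ 0 ∨ Δ q.2.1 q.1.1 ≠ 0) with hadjΔ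
  have hdegΔ : ∀ i ∈ X'', (X''.filter fun l => adjΔ i l).card ≤ C2 := by
    intro i _
    refine le_trans (card_le_card fun l hl => ?_) (hC2 i)
    obtain ⟨hlX, q, hq, hq'⟩ := mem_filter.1 hl
    refine mem_filter.2 ⟨hlX, ?_⟩
    have hd1 : d q.1.1 q.2.1 ≤ 1 := by
      by_contra hlt
      rw [not_le] at hlt
      rcases hq' with h | h
      · exact h (hband _ _ hlt)
      · exact h (hband _ _ (by rwa [hdsymm]))
    have hg := hgeo q.1.1 q.2.1
    rcases hq with ⟨h1', h2'⟩ | ⟨h1', h2'⟩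
    · rw [h1', h2'] at hg
      nlinarith
    · rw [h1', h2', hcdsymm] at hg
      nlinarith
  -- Σ_σ (coupled pairings, `2|σ| ≥ |X″|`) and the exponents, from the bound vertex structure by vertex structure
  have hθ0 : 0 < θ := hek.trans_le hekθ
  have hM0 : 0 ≤ θ ^ H.card * AV ^ (s₀ * X''.card) := mul_nonneg (pow_nonneg hθ0.le _) (pow_nonneg (zero_le_one.trans hAV) _)
  have hk : ((X'' \ H.image (cubeIn cube X ∘ γ')).card : ℝ) ≤ X''.card := by exact_mod_cast card_le_card sdiff_subset
  refine (BIJ88TrainCountingBudget307.sum_smallParts_coupled_pow_le X'' adjΔ hdegΔ _ hM0 hρ0 hρ1 ?_ ?_).trans ?_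
  rotate_left 2
  · -- the exponents
    calc ((C2 : ℝ) + 1) ^ X''.card * (θ ^ H.card * AV ^ (s₀ * X''.card)) * ρ ^ X''.card
        = θ ^ H.card * (((C2 : ℝ) + 1) * AV ^ s₀ * ρ) ^ X''.card := by rw [mul_pow, mul_pow, ← pow_mul]; ring
      _ ≤ θ ^ ((H.card : ℝ) + β' * ((X'' \ H.image (cubeIn cube X ∘ γ')).card : ℝ)) :=
          BIJ88TrainCountingBudget307.pow_mul_pow_le_rpow hθ0 hθ1 hβ (mul_nonneg (by positivity) (pow_nonneg (zero_le_one.trans hAV) _))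
            hρ0 hfinal hk
  · -- a vertex structure with an uncoupled pair block contributes nothing: its train has `K_b = ∅`, so `κ = 0`
    intro σ hσmem hunc
    obtain ⟨B', hB'σ, i, hi, l, hl, hil, hncoup⟩ := hunc
    obtain ⟨hσpart, hσsmall⟩ := mem_smallParts.1 hσmem
    -- the pair block `B' = {i, l}` has no crossing pair
    have hB'2 : B'.card = 2 := le_antisymm (hσsmall B' hB'σ) (by
      rw [show (2 : ℕ) = ({i, l} : Finset I).card by rw [card_pair hil]]
      exact card_le_card (by
        intro v hv; rcases mem_insert.1 hv with rfl | hv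
        · exact hi
        · rw [mem_singleton.1 hv]; exact hl))
    have hB'eq : ∀ v ∈ B', v = i ∨ v = l := by
      intro v hv
      by_contra hne
      simp only [not_or] at hne
      have h3 : ({i, l, v} : Finset I) ⊆ B' := by
        intro u hu
        simp only [mem_insert, mem_singleton] at hu
        rcases hu with rfl | rfl | rfl
        · exact hi
        · exact hl
        · exact hv
      have h4 := card_le_card h3
      rw [card_insert_of_notMem (by simp [hil, Ne.symm hne.1]), card_pair (Ne.symm hne.2), hB'2] at h4
      omega
    have hKB' : K B' = ∅ := by
      refine eq_empty_of_forall_notMem fun q hq => hncoup ?_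
      obtain ⟨-, h1q, h2q, h3q, h4q⟩ := mem_filter.1 hq
      have hboth := h2q (by rw [hB'2]; norm_num)
      refine ⟨q, ?_, h4q⟩
      rcases hB'eq _ hboth.1 with h5 | h5 <;> rcases hB'eq _ hboth.2 with h6 | h6
      · exact absurd (h5.trans h6.symm) h3q
      · exact Or.inl ⟨h5, h6⟩
      · exact Or.inr ⟨h5, h6⟩
      · exact absurd (h5.trans h6.symm) h3q
    have hκ0 : ∀ cg : Finset (Finset I), B' ∈ cg → ∀ x y, κc cg x y = 0 := by
      intro cg hcg x y
      rw [hκc]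
      have hne : ¬∀ b ∈ cg, (K b).Nonempty := fun h => by
        have := h B' hcg; rw [hKB'] at this; exact Finset.not_nonempty_empty this
      simp only [if_neg hne]
    refine le_of_eq (sum_eq_zero fun P hP => sum_eq_zero fun E _ => sum_eq_zero fun g _ => ?_)
    obtain ⟨cg, hcgP, hB'cg⟩ := (mem_setPartitions.1 hP).exists_mem hB'σ
    obtain ⟨k, hk⟩ := List.mem_iff_get.1 (Finset.mem_toList.2 hcgP)
    have hes : (∏ k, Sum.elim (fun x => ∑ y, κc (P.toList.get k) x y * Fq y)
        (fun xy => (1 / 2 : ℝ) * κc (P.toList.get k) xy.1 xy.2) (E k)) = 0 := by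
      refine prod_eq_zero (mem_univ k) ?_
      rw [hk]
      cases E k with
      | inl x => simp only [Sum.elim_inl]; exact sum_eq_zero fun y _ => by rw [hκ0 cg hB'cg, zero_mul]
      | inr xy => simp only [Sum.elim_inr]; rw [hκ0 cg hB'cg, mul_zero]
    rw [hes, zero_mul, zero_mul]
  · -- a coupled vertex structure: the train letter, `BIJ88TrainGainAssembly309`, `BIJ88TrainCountingBudget307` §2
    intro σ hσmem hcoup
    obtain ⟨hσpart, hσsmall⟩ := mem_smallParts.1 hσmem
    have hRHS0 : 0 ≤ θ ^ H.card * AV ^ (s₀ * X''.card) * (ρ ^ 2) ^ σ.card := mul_nonneg hM0 (pow_nonneg (pow_nonneg hρ0 _) _)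
    by_cases hall : ∀ b ∈ σ, (K b).Nonempty
    swap
    · -- some boundary term has no crossing pair: every term vanishes
      simp only [not_forall, not_nonempty_iff_eq_empty, exists_prop] at hall
      obtain ⟨B', hB'σ, hKB'⟩ := hall
      have hκ0 : ∀ cg : Finset (Finset I), B' ∈ cg → ∀ x y, κc cg x y = 0 := by
        intro cg hcg x y
        rw [hκc]
        have hne : ¬∀ b ∈ cg, (K b).Nonempty := fun h => by
          have := h B' hcg; rw [hKB'] at this; exact Finset.not_nonempty_empty this
        simp only [if_neg hne]
      refine le_trans (le_of_eq (sum_eq_zero fun P hP => sum_eq_zero fun E _ => sum_eq_zero fun g _ => ?_)) hRHS0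
      obtain ⟨cg, hcgP, hB'cg⟩ := (mem_setPartitions.1 hP).exists_mem hB'σ
      obtain ⟨k, hk⟩ := List.mem_iff_get.1 (Finset.mem_toList.2 hcgP)
      have hes : (∏ k, Sum.elim (fun x => ∑ y, κc (P.toList.get k) x y * Fq y)
          (fun xy => (1 / 2 : ℝ) * κc (P.toList.get k) xy.1 xy.2) (E k)) = 0 := by
        refine prod_eq_zero (mem_univ k) ?_
        rw [hk]
        cases E k with
        | inl x => simp only [Sum.elim_inl]; exact sum_eq_zero fun y _ => by rw [hκ0 cg hB'cg, zero_mul]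
        | inr xy => simp only [Sum.elim_inr]; rw [hκ0 cg hB'cg, mul_zero]
      rw [hes, zero_mul, zero_mul]
    -- all boundary terms have crossing pairs: the supports are nonempty
    have hSne : ∀ b ∈ σ, (Sb b).Nonempty := fun b hb => by
      obtain ⟨q, hq⟩ := hall b hb
      exact ⟨q.1, (hKS b q hq).1⟩
    -- per-train letters for `BIJ88TrainGainAssembly309`
    set T : Finset (↥(slotB B Ys cube X) ⊕ ↥(slotY B Ys cube X)) := univ.filter (fun τ => cubeIn cube X τ ∈ X'') with hT
    set A₁ : ℝ := 2 / m * Z * (2 * hΔoff * z) * Real.exp (μ / 2 * 1) with hA₁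
    set R₂ : ℝ := ϑ * (F₁ * (max aχ aV * (Real.exp (sG * (dim * (2 * (2 * Cg)) ^ ((dim : ℝ)⁻¹))) *
        Real.exp (μ / 2 / 2 * (r₀ + 1))) * w₁ * Zs) + 1 / 2 * (max aχ aV * (Real.exp (sG * (dim * (2 * (2 * Cg)) ^ ((dim : ℝ)⁻¹))) *
        Real.exp (μ / 2 / 2 * (r₀ + 1))) * w₁ * Zs) ^ 2) with hR₂
    set lastA : List (Finset I) → Finset I := fun ℓ => match ℓ with
      | [] => ∅
      | b :: u => (b :: anchorsFrom touch b u).getLast (List.cons_ne_nil _ _) with hlastA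
    -- nonnegativity of the letters
    obtain ⟨x₀, hx₀⟩ := hXs
    have hdnn : ∀ x y, 0 ≤ d x y := fun x y => by
      have h1 := hdtri x y x; rw [hd0, hdsymm y x] at h1; linarith
    have hZ0 : 0 ≤ Z := le_trans (sum_nonneg fun x _ => (Real.exp_pos _).le) (hZ ⟨x₀, hx₀⟩)
    have hz0 : 0 ≤ z := le_trans (Nat.cast_nonneg _) (hz x₀)
    have hA₁0 : 0 ≤ A₁ := by rw [hA₁]; positivity
    have hDblk0 : ∀ b u, 0 ≤ Dblk b u := fun b u => sdist_nonneg dS (fun a b => hdnn a.1 b.1) _ _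
    have hZc0 : 0 ≤ Zc := le_trans (sum_nonneg fun i _ => (Real.exp_pos _).le) (hZc (blk x₀))
    have hZs0 : 0 ≤ Zs := le_trans (mul_nonneg (Nat.cast_nonneg _) (mul_nonneg (by norm_num) hZc0)) hZs
    have hF₀ : 0 ≤ F₀ := le_trans ((abs_nonneg _).trans (hFq ⟨x₀, hx₀⟩)) (hFq1 _)
    have hzc0 : 0 ≤ zc := le_trans (Nat.cast_nonneg _) (hzc (blk x₀))
    have hF₁0 : 0 ≤ F₁ :=
      le_trans (mul_nonneg (mul_nonneg hF₀ (mul_nonneg zero_le_two (mul_nonneg hzc0 (by linarith)))) hZ0) hF₁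
    have hcK0 : 0 ≤ max aχ aV * (Real.exp (sG * (dim * (2 * (2 * Cg)) ^ ((dim : ℝ)⁻¹))) * Real.exp (μ / 2 / 2 * (r₀ + 1))) * w₁ * Zs :=
      mul_nonneg (mul_nonneg (mul_nonneg (haχ.trans (le_max_left _ _)) (by positivity)) hw₁) hZs0
    have hR₂0 : 0 ≤ R₂ := by
      rw [hR₂]; exact mul_nonneg hϑ0 (add_nonneg (mul_nonneg hF₁0 hcK0) (mul_nonneg (by norm_num) (pow_nonneg hcK0 _)))
    -- the touching degree and the sparseness on the blocks of `σ`
    have hsub : ∀ u ∈ σ, u ⊆ X'' := fun u hu => hσpart.subset hu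
    have hsdcd : ∀ b ∈ σ, ∀ u ∈ σ, r * sdist cd b u - (r₀ + 2) ≤ Dblk b u := fun b hb u hu =>
      BIJ88TrainGeometryLetters309.le_sdist_supports (fun x : BIJ88PolymerRep5134Gauss.Site blk X'' => blk x.1) dS cd
        (fun x y => hdsymm x.1 y.1) (fun x y w => hdtri x.1 y.1 w.1) hr.le (fun x y => hgeo x.1 y.1) b u (Sb b) (Sb u)
        (hSne b hb) (hSne u hu) (hSnear b) (hSnear u)
    have hdeg : ∀ b ∈ σ, (σ.filter fun u => touch b u).card ≤ 2 * C2 := by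
      intro b hb
      refine le_trans (BIJ88TrainGeometryLetters309.card_filter_touch_le cd X'' σ hσpart.pairwiseDisjoint hsub b (fun u => touch b u)
        (fun u hu htu => ?_) hC2) (Nat.mul_le_mul_right _ (hσsmall b hb))
      have h1 := hsdcd b hb u hu
      have h2 : touch b u := htu
      simp only [htouch] at h2
      have h3 : sdist cd b u < 2 := by nlinarith
      obtain ⟨i, hi, i', hi', h4⟩ := exists_sdist_eq cd (hσpart.nonempty_of_mem hb) (hσpart.nonempty_of_mem hu)
      exact ⟨i, hi, i', hi', by rw [← h4]; exact h3⟩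
    have hG' : ∀ b ∈ σ, ∑ u ∈ σ.filter (fun u => ¬touch b u), Real.exp (-(μ / 2 / 2 * Dblk b u)) ≤ G := by
      intro b hb
      have h1 : ∀ u ∈ σ.filter (fun u => ¬touch b u), Real.exp (-(μ / 2 / 2 * Dblk b u)) ≤
          Real.exp (-(μ / 2 / 2 / 2 * (2 * r - (r₀ + 2)))) * Real.exp (μ / 2 / 2 / 2 * (r₀ + 2)) *
            Real.exp (-(μ / 2 / 2 / 2 * r * sdist cd b u)) := by
        intro u hu
        obtain ⟨huσ, hnt⟩ := mem_filter.1 hu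
        simp only [htouch, not_lt] at hnt
        have h2 := hsdcd b hb u huσ
        rw [← Real.exp_add, ← Real.exp_add]
        exact Real.exp_le_exp.2 (by nlinarith)
      refine (sum_le_sum h1).trans ?_
      rw [← mul_sum]
      refine le_trans (mul_le_mul_of_nonneg_left ((sum_le_sum_of_subset_of_nonneg (filter_subset _ σ)
        (fun u _ _ => (Real.exp_pos _).le)).trans
        ((BIJ88TrainGeometryLetters309.sum_exp_neg_sdist_blocks_le cd X'' σ hσpart.pairwiseDisjoint hsub
          (fun u hu => hσpart.nonempty_of_mem hu) b (hσpart.nonempty_of_mem hb) hZc2).trans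
          (mul_le_mul_of_nonneg_right (show (b.card : ℝ) ≤ 2 by exact_mod_cast hσsmall b hb)
            (le_trans (sum_nonneg fun i _ => (Real.exp_pos _).le) (hZc2 (blk x₀)))))) (by positivity)) ?_
      exact hG
    -- the bound grouping by grouping
    have hP : ∀ P ∈ setPartitions σ,
        ∑ E : Fin P.toList.length → BIJ88PolymerRep5134Gauss.Site blk X'' ⊕
            (BIJ88PolymerRep5134Gauss.Site blk X'' × BIJ88PolymerRep5134Gauss.Site blk X''),
          ∑ g ∈ Fintype.piFinset (fun j => if j ∈ trainLegs E then T else {τ₀}),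
            (∏ k, Sum.elim (fun x => ∑ y, κc (P.toList.get k) x y * Fq y)
                (fun xy => (1 / 2 : ℝ) * κc (P.toList.get k) xy.1 xy.2) (E k)) *
              (∏ τ ∈ T, (A τ (H.filter fun j => γ' j = τ).card ((trainLegs E).filter fun j => g j = τ).card *
                  ∏ j ∈ (trainLegs E).filter (fun j => g j = τ), w τ (trainSite E j))) *
              ∏ b ∈ (univ.filter fun b : ↥(slotB B Ys cube X) => cubeIn cube X (Sum.inl b) ∈ X'').attach.filter (fun b =>
                  (H.filter fun j => γ' j = Sum.inl b.1).card ≠ 0 ∨ ((trainLegs E).filter fun j => g j = Sum.inl b.1).card ≠ 0),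
                2 * Real.exp (-(a b.1 * (a b.1 - 2 * (Λinf * (2 / m * F₀ * Z))) / (2 * (Λ ^ 2 / m)))) ≤
        θ ^ H.card * AV ^ (s₀ * X''.card) *
          ∏ cg ∈ P, ((∑ ℓ ∈ cg.val.lists.toFinset, 2 / m * A₁ ^ cg.card * Real.exp (-(μ / 2 * anchorLen touch Dblk ℓ))) * R₂) := by
      intro P hP0
      have hPpart := mem_setPartitions.1 hP0
      have hget : ∀ k : Fin P.toList.length, P.toList.get k ∈ P := fun k => Finset.mem_toList.1 (List.get_mem _ _)
      have hgetσ : ∀ k : Fin P.toList.length, ∀ b ∈ P.toList.get k, b ∈ σ := fun k b hb => hPpart.subset (hget k) hb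
      have hT' : ∀ τ ∈ T, cubeIn cube X τ ∈ X'' := fun τ hτ => (mem_filter.1 hτ).2
      -- orderings of a train are nonempty lists of its boundary terms
      have hordmem : ∀ k, ∀ ℓ ∈ (P.toList.get k).val.lists.toFinset, ∀ u, u ∈ ℓ ↔ u ∈ P.toList.get k :=
        fun k ℓ hℓ => (BIJ88TrainCountingBudget307.nodup_of_mem_orderings hℓ).2
      have hordne : ∀ k, ∀ ℓ ∈ (P.toList.get k).val.lists.toFinset, ℓ ≠ [] := by
        intro k ℓ hℓ hnil
        have h1 := BIJ88TrainCountingBudget307.length_of_mem_orderings hℓ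
        rw [hnil, List.length_nil] at h1
        exact absurd h1.symm (Nat.pos_iff_ne_zero.1 (card_pos.2 (hPpart.nonempty_of_mem (hget k))))
      have hheadmem : ∀ k, ∀ ℓ ∈ (P.toList.get k).val.lists.toFinset, ℓ.headD ∅ ∈ P.toList.get k := by
        intro k ℓ hℓ
        obtain ⟨b, u, rfl⟩ := List.exists_cons_of_ne_nil (hordne k ℓ hℓ)
        exact (hordmem k _ hℓ b).1 (List.mem_cons_self)
      have hlastmem : ∀ k, ∀ ℓ ∈ (P.toList.get k).val.lists.toFinset, lastA ℓ ∈ P.toList.get k := by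
        intro k ℓ hℓ
        obtain ⟨b, u, rfl⟩ := List.exists_cons_of_ne_nil (hordne k ℓ hℓ)
        exact (hordmem k _ hℓ _).1 (BIJ88TrainDecayLetter309.getLast_anchors_mem touch b u)
      -- sites per cube and local volume on the sites of `X″`
      have hzc' : ∀ i, ((univ.filter fun x : BIJ88PolymerRep5134Gauss.Site blk X'' => blk x.1 = i).card : ℝ) ≤ zc := by
        intro i
        refine le_trans ?_ (hzc i)
        exact_mod_cast card_le_card_of_injOn (fun x : BIJ88PolymerRep5134Gauss.Site blk X'' => x.1)
          (fun x hx => by simpa using hx) (Set.injOn_of_injective Subtype.val_injective)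
      have hz1' : ∀ y' : BIJ88PolymerRep5134Gauss.Site blk X'',
          ((univ.filter fun y : BIJ88PolymerRep5134Gauss.Site blk X'' => dS y y' ≤ 1).card : ℝ) ≤ z + 1 := by
        intro y'
        have h1 : (univ.filter fun y : BIJ88PolymerRep5134Gauss.Site blk X'' => dS y y' ≤ 1).card ≤
            (insert y'.1 (univ.filter fun y : α => y ≠ y'.1 ∧ d y'.1 y ≤ 1)).card := by
          refine card_le_card_of_injOn (fun x : BIJ88PolymerRep5134Gauss.Site blk X'' => x.1) (fun x hx => ?_)
            (Set.injOn_of_injective Subtype.val_injective)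
          have hx' : d x.1 y'.1 ≤ 1 := by simpa [hdS] using hx
          rw [coe_insert, Set.mem_insert_iff]
          by_cases hxy : x.1 = y'.1
          · exact Or.inl hxy
          · exact Or.inr (by simpa using ⟨hxy, by rwa [hdsymm]⟩)
        calc ((univ.filter fun y : BIJ88PolymerRep5134Gauss.Site blk X'' => dS y y' ≤ 1).card : ℝ)
            ≤ ((insert y'.1 (univ.filter fun y : α => y ≠ y'.1 ∧ d y'.1 y ≤ 1)).card : ℝ) := by exact_mod_cast h1
          _ ≤ ((univ.filter fun y : α => y ≠ y'.1 ∧ d y'.1 y ≤ 1).card : ℝ) + 1 := by exact_mod_cast card_insert_le _ _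
          _ ≤ z + 1 := by linarith [hz y'.1]
      have hSbcard : ∀ b ∈ σ, ((Sb b).card : ℝ) ≤ 2 * (zc * (z + 1)) := fun b hb =>
        (BIJ88TrainGeometryLetters309.card_support_le (fun x : BIJ88PolymerRep5134Gauss.Site blk X'' => blk x.1) dS b (Sb b)
          (hSnear b) (by linarith) hzc' hz1').trans
          (mul_le_mul_of_nonneg_right (by exact_mod_cast hσsmall b hb) (mul_nonneg hzc0 (by linarith)))
      -- the assembly of `BIJ88TrainGainAssembly309`
      have hAT := BIJ88TrainGainAssembly309.sum_endData_sum_asg_le_of_kernel (n := P.toList.length) T τ₀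
        (fun τ : ↥(slotB B Ys cube X) ⊕ ↥(slotY B Ys cube X) => τ.isLeft = true) A w (fun τ => (H.filter fun j => γ' j = τ).card)
        (fun τ => Sum.elim (fun b : ↥(slotB B Ys cube X) => 2 * Real.exp (-(a b * (a b - 2 * (Λinf * (2 / m * F₀ * Z))) / (2 * (Λ ^ 2 / m)))))
          (fun _ => (0 : ℝ)) τ)
        (fun k => (P.toList.get k).val.lists.toFinset)
        (fun k ℓ τ => min (sdist cd {cubeIn cube X τ} (ℓ.headD ∅)) (sdist cd {cubeIn cube X τ} (lastA ℓ)))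
        (fun k ℓ => 2 / m * A₁ ^ (P.toList.get k).card * Real.exp (-(μ / 2 * anchorLen touch Dblk ℓ)))
        (fun k ℓ x => Real.exp (-(μ / 2 * sdist dS {x} (Sb (ℓ.headD ∅)))))
        (fun k ℓ y => Real.exp (-(μ / 2 * sdist dS (Sb (lastA ℓ)) {y})))
        (fun k => κc (P.toList.get k)) Fq
        (t := t) (ek := ek) (θ := θ) (θS := θS) (θV := θV) (η := η) (Aχ := Aχ) (AV := AV) (aχ := aχ) (aV := aV) (s := sG)
        (μ := μ / 2) (r := r) (r₀ := r₀ + 1) (C₀ := Cg) (ϑ := ϑ) (F₁ := F₁) (w₁ := w₁) (Zs := Zs) (M := M) (dim := dim) (Nn := Nn)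
        ht ht1 hek.le hekθ hθ1 hθS0 hη0 hη1 hθSη hAχ0 hAχη haχ hθV0 hθVθ hAV haV hsG (by linarith) hr.le hCg hdim hNn hϑ0 hϑ1
        hηϑ hθVϑ hfar hfac hNn2 hw (fun τ _ => hw1 τ) hA
        (fun τ hτ hχτ nn hmn => by
          obtain ⟨b, rfl⟩ := Sum.isLeft_iff.1 hχτ
          exact hAχ' b (hT' _ hτ) _ nn (hHM _) hmn)
        (fun τ hτ hχτ => by
          obtain ⟨b, rfl⟩ := Sum.isLeft_iff.1 hχτ
          exact hA10 b)
        (fun τ hτ hχτ => by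
          obtain ⟨b, rfl⟩ := Sum.isLeft_iff.1 hχτ
          simp only [Sum.elim_inl]; positivity)
        (fun τ hτ hχτ => by
          obtain ⟨b, rfl⟩ := Sum.isLeft_iff.1 hχτ
          simp only [Sum.elim_inl]; exact hS b (hT' _ hτ))
        (fun τ _ _ => hHM τ)
        (fun τ hτ hχτ nn => by
          cases τ with
          | inl b => exact absurd Sum.isLeft_inl hχτ
          | inr Y => exact hAV' Y _ nn (hHM _))
        (fun k ℓ _ τ _ => le_min (sdist_nonneg cd hcd0 _ _) (sdist_nonneg cd hcd0 _ _))
        ?_ hZs0 ?_ hw₁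
        (fun k ℓ _ => mul_nonneg (mul_nonneg (by positivity) (pow_nonneg hA₁0 _)) (Real.exp_pos _).le)
        (fun k ℓ _ x => (Real.exp_pos _).le) (fun k ℓ _ y => (Real.exp_pos _).le)
        (fun y => (abs_nonneg _).trans (hFq y)) hF₁0 ?_ ?_ ?_ ?_ ?_
      rotate_left
      · -- hgr: disjoint trains near a cube are few
        intro oo hoo τ hτ kk hkk
        have ho : ∀ k, oo k ∈ (P.toList.get k).val.lists.toFinset := fun k => Fintype.mem_piFinset.1 hoo k
        have hnd : P.toList.Nodup := P.nodup_toList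
        refine le_trans ?_ (hgrowth (cubeIn cube X τ) kk hkk)
        exact_mod_cast BIJ88TrainGeometryLetters309.card_filter_lt_le_of_disjoint cd X'' (fun k => (P.toList.get k).biUnion id)
          (fun k i hi => by
            obtain ⟨b, hb, hib⟩ := mem_biUnion.1 hi
            exact hσpart.subset (hgetσ k b hb) hib)
          (fun k k' hkk' => by
            have hne : P.toList.get k ≠ P.toList.get k' := fun h => hkk' (hnd.get_inj_iff.1 h)
            have hdis := hPpart.disjoint (hget k) (hget k') hne
            refine (disjoint_biUnion_left _ _ _).2 fun b hb => (disjoint_biUnion_right _ _ _).2 fun b' hb' => ?_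
            have hbb' : b ≠ b' := fun h => disjoint_left.1 hdis hb (h ▸ hb')
            exact hσpart.disjoint (hgetσ k b hb) (hgetσ k' b' hb') hbb')
          (fun k => min (sdist cd {cubeIn cube X τ} ((oo k).headD ∅)) (sdist cd {cubeIn cube X τ} (lastA (oo k))))
          (cubeIn cube X τ)
          (fun k hk => by
            rcases min_lt_iff.1 hk with hk | hk
            · obtain ⟨i₁, hi₁, i, hi, h⟩ := exists_sdist_eq cd (singleton_nonempty _)
                (hσpart.nonempty_of_mem (hgetσ k _ (hheadmem k _ (ho k))))
              rw [mem_singleton.1 hi₁] at h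
              exact ⟨i, mem_biUnion.2 ⟨_, hheadmem k _ (ho k), hi⟩, by rw [← h]; exact hk⟩
            · obtain ⟨i₁, hi₁, i, hi, h⟩ := exists_sdist_eq cd (singleton_nonempty _)
                (hσpart.nonempty_of_mem (hgetσ k _ (hlastmem k _ (ho k))))
              rw [mem_singleton.1 hi₁] at h
              exact ⟨i, mem_biUnion.2 ⟨_, hlastmem k _ (ho k), hi⟩, by rw [← h]; exact hk⟩)
      · -- hZs: the slot lattice sum
        intro k ℓ hℓ
        have hs₀' : ∀ i ∈ X'', (T.filter fun τ => cubeIn cube X τ = i).card ≤ s₀ := fun i hi =>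
          (card_le_card (filter_subset_filter _ (filter_subset _ _))).trans (hs₀ i hi)
        have hblk : ∀ b ∈ σ, ∑ τ ∈ T, Real.exp (-(μ / 2 / 4 * max (r * sdist cd {cubeIn cube X τ} b - (r₀ + 1)) 0)) ≤ s₀ * (2 * Zc) := by
          intro b hb
          refine (BIJ88TrainGeometryLetters309.sum_slots_le_mul_sum T (cubeIn cube X) X'' hT' hs₀'
            (fun i => Real.exp (-(μ / 2 / 4 * max (r * sdist cd {i} b - (r₀ + 1)) 0))) (fun i _ => (Real.exp_pos _).le)).trans ?_
          refine mul_le_mul_of_nonneg_left ((BIJ88TrainGeometryLetters309.sum_exp_neg_max_sdist_le cd X'' b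
            (hσpart.nonempty_of_mem hb) hZc).trans (mul_le_mul_of_nonneg_right (by exact_mod_cast hσsmall b hb) hZc0)) (Nat.cast_nonneg _)
        calc ∑ τ ∈ T, Real.exp (-(μ / 2 / 4 * max (r * min (sdist cd {cubeIn cube X τ} (ℓ.headD ∅))
              (sdist cd {cubeIn cube X τ} (lastA ℓ)) - (r₀ + 1)) 0))
            ≤ ∑ τ ∈ T, (Real.exp (-(μ / 2 / 4 * max (r * sdist cd {cubeIn cube X τ} (ℓ.headD ∅) - (r₀ + 1)) 0)) +
                Real.exp (-(μ / 2 / 4 * max (r * sdist cd {cubeIn cube X τ} (lastA ℓ) - (r₀ + 1)) 0))) :=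
              sum_le_sum fun τ _ => BIJ88TrainGeometryLetters309.exp_neg_max_min_le_add _ _ _ _ _
          _ ≤ s₀ * (2 * Zc) + s₀ * (2 * Zc) := by
              rw [sum_add_distrib]
              exact add_le_add (hblk _ (hgetσ k _ (hheadmem k ℓ hℓ))) (hblk _ (hgetσ k _ (hlastmem k ℓ hℓ)))
          _ = (s₀ : ℝ) * (4 * Zc) := by ring
          _ ≤ Zs := hZs
      · -- hUF: the source letter
        intro k ℓ hℓ
        have hb := hgetσ k _ (hlastmem k ℓ hℓ)
        refine (BIJ88TrainGeometryLetters309.sum_exp_neg_sdist_mul_le dS (Sb (lastA ℓ)) (hSne _ hb) Fq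
          (fun y => (abs_nonneg _).trans (hFq y)) hFq1 (fun y' => hZ y')).trans ?_
        refine le_trans (mul_le_mul_of_nonneg_left (mul_le_mul_of_nonneg_right (hSbcard _ hb) hZ0) hF₀) ?_
        calc F₀ * (2 * (zc * (z + 1)) * Z) = F₀ * ((2 : ℝ) * (zc * (z + 1))) * Z := by ring
          _ ≤ F₁ := hF₁
      · -- hUδ: the entry stretch of a leg on a located slot
        intro k ℓ hℓ τ hτ x hwx
        have hb := hgetσ k _ (hheadmem k ℓ hℓ)
        have hcube : blk x.1 = cubeIn cube X τ := hwloc τ x hwx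
        exact BIJ88TrainGeometryLetters309.exp_neg_sdist_singleton_left_le (fun x : BIJ88PolymerRep5134Gauss.Site blk X'' => blk x.1)
          dS cd (fun x y => hdnn x.1 y.1) (fun x y w => hdtri x.1 y.1 w.1) hr.le (by linarith) (fun x y => hgeo x.1 y.1) _ (Sb _)
          (hSne _ hb) (hSnear _) x (fun i' hi' => (min_le_left _ _).trans (by rw [hcube]; exact sdist_le cd (mem_singleton_self _) hi'))
      · -- hU′δ: the exit stretch
        intro k ℓ hℓ τ hτ x hwx
        have hb := hgetσ k _ (hlastmem k ℓ hℓ)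
        have hcube : blk x.1 = cubeIn cube X τ := hwloc τ x hwx
        exact BIJ88TrainGeometryLetters309.exp_neg_sdist_singleton_right_le (fun x : BIJ88PolymerRep5134Gauss.Site blk X'' => blk x.1)
          dS cd (fun x y => hdnn x.1 y.1) (fun x y => hdsymm x.1 y.1) (fun x y w => hdtri x.1 y.1 w.1) hr.le (by linarith)
          (fun x y => hgeo x.1 y.1) _ (Sb _) (hSne _ hb) (hSnear _) x
          (fun i' hi' => (min_le_right _ _).trans (by rw [hcube]; exact sdist_le cd (mem_singleton_self _) hi'))
      · -- hκ0
        intro k x y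
        rw [hκc]
        simp only
        split_ifs
        · exact mul_nonneg (mul_nonneg (by positivity) (pow_nonneg hA₁0 _)) (sum_nonneg fun ℓ _ => (Real.exp_pos _).le)
        · exact le_rfl
      · -- hκ: the train letter factorizes over the two ends along [9]'s anchors
        intro k x y
        rw [hκc]
        simp only
        rw [if_pos (fun b hb => hall b (hgetσ k b hb)), mul_sum]
        refine sum_le_sum fun ℓ hℓ => le_of_eq ?_
        obtain ⟨b, u, rfl⟩ := List.exists_cons_of_ne_nil (hordne k ℓ hℓ)
        rw [BIJ88TrainDecayLetter309.chainLen_anchors_cons dS Sb y touch x b u]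
        simp only [List.headD_cons, hlastA]
        rw [show -(μ / 2 * (sdist dS {x} (Sb b) + anchorLen touch (fun b b' => sdist dS (Sb b) (Sb b')) (b :: u) +
            sdist dS (Sb ((b :: anchorsFrom touch b u).getLast (List.cons_ne_nil _ _))) {y})) =
            -(μ / 2 * anchorLen touch Dblk (b :: u)) + -(μ / 2 * sdist dS {x} (Sb b)) +
              -(μ / 2 * sdist dS (Sb ((b :: anchorsFrom touch b u).getLast (List.cons_ne_nil _ _))) {y}) by
            simp only [hDblk]; ring, Real.exp_add, Real.exp_add]
        ring
      -- from the assembly to the grouping's product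
      refine le_trans (le_of_eq (sum_congr rfl fun E _ => sum_congr rfl fun g _ => ?_)) (hAT.trans ?_)
      · -- the shell product of the master bound, slot by slot
        rw [mul_assoc]
        congr 1
        congr 1
        rw [prod_filter, prod_attach (univ.filter fun b : ↥(slotB B Ys cube X) => cubeIn cube X (Sum.inl b) ∈ X'')
          (fun b => if (H.filter fun j => γ' j = Sum.inl b).card ≠ 0 ∨ ((trainLegs E).filter fun j => g j = Sum.inl b).card ≠ 0 then
            2 * Real.exp (-(a b * (a b - 2 * (Λinf * (2 / m * F₀ * Z))) / (2 * (Λ ^ 2 / m)))) else 1), ← prod_filter]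
        have hTχ : T.filter (fun τ : ↥(slotB B Ys cube X) ⊕ ↥(slotY B Ys cube X) => τ.isLeft = true) =
            (univ.filter fun b : ↥(slotB B Ys cube X) => cubeIn cube X (Sum.inl b) ∈ X'').map ⟨Sum.inl, Sum.inl_injective⟩ := by
          ext τ
          simp only [hT, mem_filter, mem_univ, true_and, mem_map, Function.Embedding.coeFn_mk]
          constructor
          · rintro ⟨hτ, hχ⟩
            obtain ⟨b, rfl⟩ := Sum.isLeft_iff.1 hχ
            exact ⟨b, hτ, rfl⟩
          · rintro ⟨b, hb, rfl⟩
            exact ⟨hb, Sum.isLeft_inl⟩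
        rw [hTχ, filter_map, prod_map]
        rfl
      · -- `Σ_τ m_τ = |H|`, `#V-slots ≤ s₀|X″|`, `Π_k` over the list of trains = `Π_{c ∈ P}`
        have hm : ∑ τ ∈ T, (H.filter fun j => γ' j = τ).card = H.card :=
          (card_eq_sum_card_fiberwise (f := γ') (s := H) (t := T) fun j hj => mem_filter.2 ⟨mem_univ _, hHloc j hj⟩).symm
        have hTV : (T.filter fun τ : ↥(slotB B Ys cube X) ⊕ ↥(slotY B Ys cube X) => ¬(τ.isLeft = true)).card ≤ s₀ * X''.card := by
          refine (card_le_card (filter_subset _ _)).trans ?_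
          rw [card_eq_sum_card_fiberwise (f := cubeIn cube X) (t := X'') hT']
          refine (sum_le_sum fun i hi => (card_le_card (filter_subset_filter _ (filter_subset _ _))).trans (hs₀ i hi)).trans ?_
          rw [sum_const, smul_eq_mul, mul_comm]
        have hprodlist : ∏ k : Fin P.toList.length, ((∑ ℓ ∈ (P.toList.get k).val.lists.toFinset,
            2 / m * A₁ ^ (P.toList.get k).card * Real.exp (-(μ / 2 * anchorLen touch Dblk ℓ))) * R₂) =
            ∏ cg ∈ P, ((∑ ℓ ∈ cg.val.lists.toFinset, 2 / m * A₁ ^ cg.card * Real.exp (-(μ / 2 * anchorLen touch Dblk ℓ))) * R₂) := by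
          rw [← prod_map_toList P, ← List.prod_ofFn]
          congr 1
          rw [List.ofFn_comp' P.toList.get (fun cg => (∑ ℓ ∈ cg.val.lists.toFinset,
            2 / m * A₁ ^ cg.card * Real.exp (-(μ / 2 * anchorLen touch Dblk ℓ))) * R₂), List.ofFn_get]
        rw [hm, hprodlist]
        refine mul_le_mul_of_nonneg_right (mul_le_mul_of_nonneg_left (pow_le_pow_right₀ hAV hTV) (pow_nonneg hθ0.le _)) ?_
        exact prod_nonneg fun cg _ => mul_nonneg (sum_nonneg fun ℓ _ => mul_nonneg (mul_nonneg (by positivity) (pow_nonneg hA₁0 _))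
          (Real.exp_pos _).le) hR₂0
    -- Σ_P by [9] Prop. 8.2 (`BIJ88TrainCountingBudget307` §2)
    refine (sum_le_sum hP).trans ?_
    rw [← mul_sum]
    refine mul_le_mul_of_nonneg_left ?_ hM0
    have hbudget := BIJ88TrainCountingBudget307.sum_setPartitions_prod_train_le touch Dblk σ (c₀ := 2 * C2)
      (r₁ := 2 * r - (r₀ + 2)) (lam := μ / 2) (lam' := lam') (a₀ := 2 / m) (A₁ := A₁) (g := R₂) (G := G) (by linarith) hlam'
      (hlam'2.trans (by linarith)) (by positivity) hA₁0 hR₂0 hDblk0 (fun b u h => by simp only [htouch, not_lt] at h; exact h) hdeg hG'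
      hsmallG (by rw [hR₂]; exact hp₁)
    refine hbudget.trans ?_
    rw [show (2 : ℝ) * (((2 * C2 + 1).factorial : ℕ) : ℝ) * (σ.card : ℝ) = (σ.card : ℕ) * (2 * (((2 * C2 + 1).factorial : ℕ) : ℝ)) by
      ring, Real.exp_nat_mul, ← mul_pow]
    refine pow_le_pow_left₀ (mul_nonneg (mul_nonneg hA₁0 (Real.exp_pos _).le) (Real.exp_pos _).le) ?_ _
    rw [hA₁]
    exact hρ

set_option maxHeartbeats 1600000 in
/-- **THE LOCATED (5.14.4), SIZE-FREE, IN THE SHAPE OF THE LEAF `h5144three`** of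
`BIJ88Eq5145HeadThreeCubeChi.eq5145_zG_mod_W6v_of_ineq5144_three_le_struct_chi`: for the located activity
`locAct (cubeIn cube X ∘ γ′) (actIn …) H X″` of `BIJ88Ineq5144Located` (the activity on located pairs, `0` otherwise),
`|locAct … H X″| ≤ θ^{|H| + β′·|X″ ∖ X_H|}` for every `|X″| ≥ 2`, letters independent of `|X″|`.
[cite: BalabanImbrieJaffe1988, (5.14.3)–(5.14.4) p.309 L10–28; §5.13 p.305–307] [cite: GlimmJaffeSpencer1973, Prop. 8.1–8.2, Thm. 9.4, Lemma 10.2] -/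
theorem abs_locAct_actIn_le_rpow_sizeFree (hΔ : Δ.PosDef) {m C₀ : ℝ} (hm : 0 < m)
    (hΔm : ∀ φ : α → ℝ, m * (φ ⬝ᵥ φ) ≤ φ ⬝ᵥ (Δ *ᵥ φ)) (hCΔ : ∀ v, v ⬝ᵥ (Δ *ᵥ v) ≤ C₀ * (v ⬝ᵥ v))
    (hek : 0 < ek) (ht : 0 < t) (h1 : t * ek < 1) (hΦ : ∀ b ∈ B, IsLinearMap ℝ (Φ b)) (hc : ∀ b ∈ B, c b ≠ 0)
    (hV : ∀ Y ∈ Ys, CbInf (V Y))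
    (X : Finset I) {S : Type*} [DecidableEq S] (γ' : S → ↥(slotB B Ys cube X) ⊕ ↥(slotY B Ys cube X)) (H : Finset S)
    {X'' : Finset I} (h2 : 2 ≤ X''.card) (hXs : ∃ x, blk x ∈ X'') (τ₀ : ↥(slotB B Ys cube X) ⊕ ↥(slotY B Ys cube X))
    {Λ : ℝ} (hΛ : 0 < Λ)
    (hframe : ∀ (θ : ↥(univ.filter fun b : ↥(slotB B Ys cube X) => cubeIn cube X (Sum.inl b) ∈ X'') → ℝ) (φ : α → ℝ),
      |∑ b, θ b * Φ b.1.1 φ| ≤ Λ * Real.sqrt (∑ b, θ b ^ 2) * Real.sqrt (φ ⬝ᵥ φ))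
    {a a' : ↥(slotB B Ys cube X) → ℝ} (ha : ∀ b, 0 ≤ a b)
    {A : ↥(slotB B Ys cube X) ⊕ ↥(slotY B Ys cube X) → ℕ → ℕ → ℝ} (hA : ∀ τ m n, 0 ≤ A τ m n)
    (hA1 : ∀ b : ↥(slotB B Ys cube X), 1 ≤ A (Sum.inl b) 0 0)
    {w : ↥(slotB B Ys cube X) ⊕ ↥(slotY B Ys cube X) → BIJ88PolymerRep5134Gauss.Site blk X'' → ℝ} (hw : ∀ τ x, 0 ≤ w τ x)
    (hχ : ∀ (κ : Type) [LinearOrder κ] (q : κ → BIJ88PolymerRep5134Gauss.Site blk X'') (b : ↥(slotB B Ys cube X)) (m : ℕ)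
      (D' : Finset κ) (φ : BIJ88PolymerRep5134Gauss.Site blk X'' → ℝ), (m ≠ 0 ∨ D'.card ≠ 0) →
      |dset (fun j => Pi.single (q j) (1 : ℝ)) D'
        (fun ψ => uD χ p ek (slotB B Ys cube X) (fun b : ↥B => Φ b) (fun b : ↥B => c b) (slotY B Ys cube X) (fun Y : ↥Ys => V Y) t
          (Sum.inl b) m (ext blk X'' ψ)) φ| ≤
        A (Sum.inl b) m D'.card * (∏ j ∈ D', w (Sum.inl b) (q j)) *
          Set.indicator (Set.Icc (a b) (a' b)) (fun _ => (1 : ℝ)) |Φ b.1 (ext blk X'' φ)|)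
    (hY : ∀ (κ : Type) [LinearOrder κ] (q : κ → BIJ88PolymerRep5134Gauss.Site blk X'') (Y : ↥(slotY B Ys cube X)) (m : ℕ)
      (D' : Finset κ) (φ : BIJ88PolymerRep5134Gauss.Site blk X'' → ℝ),
      |dset (fun j => Pi.single (q j) (1 : ℝ)) D'
        (fun ψ => uD χ p ek (slotB B Ys cube X) (fun b : ↥B => Φ b) (fun b : ↥B => c b) (slotY B Ys cube X) (fun Y : ↥Ys => V Y) t
          (Sum.inr Y) m (ext blk X'' ψ)) φ| ≤
        A (Sum.inr Y) m D'.card * ∏ j ∈ D', w (Sum.inr Y) (q j))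
    {Fq : BIJ88PolymerRep5134Gauss.Site blk X'' → ℝ} (hFq : ∀ q : BIJ88PolymerRep5134Gauss.Site blk X'', |ℱ q.1| ≤ Fq q)
    -- SITE GEOMETRY (the `Δ`-letters of `BIJ88TrainDecayLetter309`)
    (d : α → α → ℝ) (hd0 : ∀ i, d i i = 0) (hdsymm : ∀ i k, d i k = d k i) (hdtri : ∀ i j k, d i k ≤ d i j + d j k)
    (hband : ∀ x y, 1 < d x y → Δ x y = 0) {hΔoff : ℝ} (hh0 : 0 ≤ hΔoff) (hh : ∀ x y, x ≠ y → |Δ x y| ≤ hΔoff)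
    {z : ℝ} (hz : ∀ x, ((univ.filter fun y => y ≠ x ∧ d x y ≤ 1).card : ℝ) ≤ z) {μ : ℝ} (hμ : 0 ≤ μ)
    (hsmallCT : hΔoff * z * (Real.exp μ - 1) ≤ m / 2) {Z : ℝ}
    (hZ : ∀ y : BIJ88PolymerRep5134Gauss.Site blk X'', ∑ x : BIJ88PolymerRep5134Gauss.Site blk X'', Real.exp (-(μ / 2 * d y.1 x.1)) ≤ Z)
    -- CUBE GEOMETRY
    (cd : I → I → ℝ) (hcd0 : ∀ i i', 0 ≤ cd i i') (hcdsymm : ∀ i i', cd i i' = cd i' i) {r r₀ : ℝ} (hr : 0 < r) (hr2 : r₀ + 2 ≤ 2 * r)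
    (hgeo : ∀ x y : α, r * cd (blk x) (blk y) - r₀ ≤ d x y) {Cg : ℝ} {dim : ℕ} (hCg : 0 < Cg) (hdim : dim ≠ 0)
    (hgrowth : ∀ (i₀ : I) (kk : ℕ), 1 ≤ kk → ((X''.filter fun i => cd i₀ i < kk).card : ℝ) ≤ Cg * (kk : ℝ) ^ dim)
    {C2 : ℕ} (hC2 : ∀ i, (X''.filter fun i' => cd i i' < 2).card ≤ C2)
    {Zc : ℝ} (hZc : ∀ i', ∑ i ∈ X'', Real.exp (-(μ / 2 / 4 * max (r * cd i i' - (r₀ + 1)) 0)) ≤ Zc)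
    {Zc2 : ℝ} (hZc2 : ∀ i, ∑ i' ∈ X'', Real.exp (-(μ / 2 / 2 / 2 * r * cd i i')) ≤ Zc2)
    {zc : ℝ} (hzc : ∀ i, ((univ.filter fun x : α => blk x = i).card : ℝ) ≤ zc)
    {s₀ : ℕ} (hs₀ : ∀ i ∈ X'', (univ.filter fun τ : ↥(slotB B Ys cube X) ⊕ ↥(slotY B Ys cube X) => cubeIn cube X τ = i).card ≤ s₀)
    {F₀ : ℝ} (hFq1 : ∀ y, Fq y ≤ F₀)
    {Λinf : ℝ} (hΦinf : ∀ b : ↥(slotB B Ys cube X), ∀ (φ : α → ℝ) (M : ℝ), 0 ≤ M → (∀ x, |φ x| ≤ M) → |Φ b.1 φ| ≤ Λinf * M)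
    -- SLOTS
    {θ θS θV η Aχ AV aχ aV sG ϑ w₁ : ℝ} {M Nn : ℕ} (ht1 : t ≤ 1) (hekθ : ek ≤ θ) (hθ1 : θ ≤ 1) (hθS0 : 0 ≤ θS) (hη0 : 0 ≤ η)
    (hη1 : η ≤ 1) (hθSη : θS ≤ η * η) (hAχ0 : 0 ≤ Aχ) (hAχη : Aχ * η ≤ 1) (haχ : 0 ≤ aχ) (hθV0 : 0 ≤ θV) (hθVθ : θV ≤ θ)
    (hAV : 1 ≤ AV) (haV : 0 ≤ aV) (hsG : 0 ≤ sG) (hNn : 1 ≤ Nn) (hϑ0 : 0 ≤ ϑ) (hϑ1 : ϑ ≤ 1) (hηϑ : η ^ ((Nn : ℝ)⁻¹) ≤ ϑ)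
    (hθVϑ : θV ≤ ϑ) (hfar : Real.exp (-(μ / 2 / 4 * (2 * r - (r₀ + 1)))) ≤ ϑ)
    (hfac : 2 * sG * (dim * (2 * (2 * Cg)) ^ ((dim : ℝ)⁻¹)) ≤ μ / 2 / 2 * r) (hNn2 : 2 * Cg * 2 ^ dim ≤ (Nn : ℝ))
    (hwloc : ∀ τ x, w τ x ≠ 0 → blk x.1 = cubeIn cube X τ)
    (hw₁ : 0 ≤ w₁) (hw1 : ∀ τ, ∑ x, w τ x ≤ w₁)
    (hAχ' : ∀ b : ↥(slotB B Ys cube X), cubeIn cube X (Sum.inl b) ∈ X'' → ∀ md nd : ℕ, md ≤ M → (md ≠ 0 ∨ nd ≠ 0) →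
      t ^ md * A (Sum.inl b) md nd ≤ Aχ ^ (if md ≠ 0 then 1 else 0) * (aχ ^ nd * ((nd.factorial : ℕ) : ℝ) ^ sG))
    (hA10 : ∀ b : ↥(slotB B Ys cube X), A (Sum.inl b) 0 0 ≤ 1)
    (hAV' : ∀ (Y : ↥(slotY B Ys cube X)) (md nd : ℕ), md ≤ M →
      A (Sum.inr Y) md nd ≤ AV * θV ^ (md + nd) * (aV ^ nd * ((nd.factorial : ℕ) : ℝ) ^ sG))
    (hS : ∀ b : ↥(slotB B Ys cube X), cubeIn cube X (Sum.inl b) ∈ X'' →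
      2 * Real.exp (-(a b * (a b - 2 * (Λinf * (2 / m * F₀ * Z))) / (2 * (Λ ^ 2 / m)))) ≤ (t * ek) ^ M * θS)
    (hHM : ∀ τ, (H.filter fun j => γ' j = τ).card ≤ M)
    -- COUNTING
    {lam' G ρ β' F₁ Zs : ℝ} (hlam' : 0 ≤ lam') (hlam'2 : lam' ≤ μ / 2 / 2 / 2)
    (hF₁ : F₀ * ((2 : ℝ) * (zc * (z + 1))) * Z ≤ F₁) (hZs : (s₀ : ℝ) * (4 * Zc) ≤ Zs)
    (hp₁ : 2 / m * (ϑ * (F₁ * (max aχ aV * (Real.exp (sG * (dim * (2 * (2 * Cg)) ^ ((dim : ℝ)⁻¹))) *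
        Real.exp (μ / 2 / 2 * (r₀ + 1))) * w₁ * Zs) + 1 / 2 * (max aχ aV * (Real.exp (sG * (dim * (2 * (2 * Cg)) ^ ((dim : ℝ)⁻¹))) *
        Real.exp (μ / 2 / 2 * (r₀ + 1))) * w₁ * Zs) ^ 2)) * Real.exp (lam' * (2 * r - (r₀ + 2))) ≤ 1)
    (hG : Real.exp (-(μ / 2 / 2 / 2 * (2 * r - (r₀ + 2)))) * Real.exp (μ / 2 / 2 / 2 * (r₀ + 2)) * (2 * Zc2) ≤ G)
    (hsmallG : 2 * ((2 * C2 + 1).factorial : ℝ) * G ≤ 1) (hρ0 : 0 ≤ ρ) (hρ1 : ρ ≤ 1)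
    (hρ : 2 / m * Z * (2 * hΔoff * z) * Real.exp (μ / 2 * 1) * Real.exp (-(lam' * (2 * r - (r₀ + 2)) / ((2 * C2 : ℕ) + 1))) *
      Real.exp (2 * ((2 * C2 + 1).factorial : ℝ)) ≤ ρ ^ 2)
    (hβ : 0 ≤ β') (hfinal : ((C2 : ℝ) + 1) * AV ^ s₀ * ρ ≤ θ ^ β')
    :
    |locAct (cubeIn cube X ∘ γ') (actIn blk Δ ℱ adj χ p ek B Φ c Ys V cube Λc X t γ') H X''| ≤
      θ ^ ((H.card : ℝ) + β' * ((X'' \ H.image (cubeIn cube X ∘ γ')).card : ℝ)) := by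
  by_cases hloc : ∀ j ∈ H, (cubeIn cube X ∘ γ') j ∈ X''
  · rw [locAct_of_loc hloc]
    exact abs_actIn_le_rpow_sizeFree blk Δ ℱ χ p B Ys cube adj Λc hΔ hm hΔm hCΔ hek ht h1 hΦ hc hV X γ' H h2 hXs τ₀ hΛ hframe ha hA hA1 hw hχ hY hFq d hd0 hdsymm hdtri hband hh0 hh hz hμ hsmallCT hZ cd hcd0 hcdsymm hr hr2 hgeo hCg hdim hgrowth hC2 hZc hZc2 hzc hs₀ hFq1 hΦinf ht1 hekθ hθ1 hθS0 hη0 hη1 hθSη hAχ0 hAχη haχ hθV0 hθVθ hAV haV hsG hNn hϑ0 hϑ1 hηϑ hθVϑ hfar hfac hNn2 hwloc hw₁ hw1 hAχ' hA10 hAV' hS hHM hlam' hlam'2 hF₁ hZs hp₁ hG hsmallG hρ0 hρ1 hρ hβ hfinal (fun j hj => hloc j hj)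
  · rw [locAct_of_not_loc hloc, abs_zero]
    exact Real.rpow_nonneg (hek.le.trans hekθ) _

end Literature.MathematicalPhysics.QuantumFieldTheory.BalabanImbrieJaffe1984to88.BIJ88Ineq5144SizeFree309
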